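import Summits.FinalStateConjecture.FinalStateConjecture.Theorems.ZeroEnergyKerrOrBombSymplecticDualOfTheBombSig
import HarnessLib

/-!
# Route ZeroEnergyKerrOrBomb · crux `StationaryLimitReduction` — vocabulary and registered stub STATEMENTS of
# reshape r4/r5 of the line `symplectic-dual-of-the-bomb` (`…'` currency and `Sig4.stub_*`; definitions only)

Third statement module of the line (after `…SymplecticDualOfTheBombDefs.lean` p101414, `…Defs2.lean` p114429,
`…Sig.lean` p116416): §0 and §1 of the checked skeleton
`Cruxes/StationaryLimitReduction/Lines/symplectic_dual_of_the_bomb.lean`, reshape r4 (lead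
prover-line-stmt-FinalStateConjecture-10021-a1-0, integrating wave 2) = r5 (lead prover-line-stmt-FinalStateConjecture-10021-a2-0,
stub 1F consumed as landed, p121011), moved VERBATIM out of the crux workfile (which has no `.olean`) so that the
wave-3 stub proofs and helper lemmas can land as `Theorems/…` files importing the REGISTERED statements
(crux stmt-FinalStateConjecture-10021, `ZeroEnergyKerrOrBomb.StationaryLimitReduction := KerrOrBomb → FinalStateConjecture`):

* §0 the r4 currency: `ChartIsAsymptoticallySchwarzschildean'` (C² rate `r^{-(n+2)}`, `n ≤ 2`, far cylinder charted
  into the d.o.c. — the wave-2 repair of the C⁰ clause of `…Defs2`), `HasExhaustiveDocCharts'` (source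
  `O ∩ I⁻(docCharted d)`, radii → ∞, overlap margin → ∞ — the wave-2 repairs V1/V2 of p116597) and
  `SettlesDocWith'` (honest exterior equation `O = exteriorOf 𝒟 d.charted` + the primed clauses);
* §1 the four restated stub statements `Sig4.stub_kerrIsometryRigidity` (1R), `Sig4.stub_recutCovering` (1G),
  `Sig4.stub_nonSettlingCure` (2), `Sig4.stub_dualModeEjection` (5); stubs 3 and 4 keep their `Sig.*` statements
  (p116416) and stub 1F is landed (`stub_chartTransferGeneral`, p121011).

Each `Sig4.stub_X` is a DEFINITION of a proposition (the text a stub worker must prove or refute), with the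
why-plausible / why-it-might-fail / wave notes in the docstrings; none is a route item, none is asserted, and the
module does not import the route file `Theses.ZeroEnergyKerrOrBomb`. Provenance of the stub statements is given in
prose as `(ref: Key, locator)` (NOT as a cite tag: they are the line's own obligations, not published facts, and must
not be relocated to `Literature/`; precedent `…SymplecticDualOfTheBombSig.lean`).
-/

-- every `Summit.FinalStateConjecture.FinalStateConjecture.…` name repeats the summit = sub-problem segment (D-0017 layout)
set_option linter.dupNamespace false
set_option maxSynthPendingDepth 3

noncomputable section

open scoped Manifold ContDiff Topology BigOperators
open Set Filter Bundle MeasureTheory Literature.Geometry.Lorentzian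

namespace Summit.FinalStateConjecture.FinalStateConjecture.Theorems.SymplecticDualOfTheBomb

open Summit.FinalStateConjecture.FinalStateConjecture.Theorems.OneLockedExplosion

/-! ## §0 Vocabulary of reshape r4/r5 (definitions over the tree and the landed Defs/Defs2 modules; nothing is asserted) -/

/-- The adapted chart `A` is **asymptotically Schwarzschildean in `C²` at rate `r⁻²`, with its far cylinder in
the d.o.c.** (r4 form, kerrIsometryRigidity worker of wave 2): for some mass `M`, far out (i) the leaf points
`(0, y)`, `‖y‖ ≥ R₀`, are charted INTO `𝓑.doc`, and (ii) the derivatives of orders `n ≤ 2` of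
`A.bilin − Kerr.bilin M 0` are `≤ C / r^{n+2}` — the control an isometry between two such charts turns into the
tilt / radial-distortion / `C¹–C³` bounds of `IsKerrChartedWith` (the r3 clause was `C⁰` only: Kerr read through
`id + r⁻⁴ sin(r³) w` defeats it). Kerr's own Kerr–Schild chart satisfies it with the same `M`
(`Kerr.bilin M a − Kerr.bilin M 0 = O(Ma/r²)` with derivatives). [cite: ChruscielCosta2008, §2.1] -/
def ChartIsAsymptoticallySchwarzschildean' {𝓑 : StationaryAFBlackHole.{0}} (A : 𝓑.AdaptedChart) : Prop :=
  ∃ M C R₀ : ℝ,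
    (∀ y : E3, R₀ ≤ ‖y‖ → ∃ h : E4.ofTimeSpace 0 y ∈ A.domain, A.toFun ⟨E4.ofTimeSpace 0 y, h⟩ ∈ 𝓑.doc) ∧
      ∀ x : A.domain, R₀ ≤ A.radius x.1 → ∀ n : ℕ, n ≤ 2 →
        ‖iteratedFDeriv ℝ n (fun y ↦ A.bilin y - Kerr.bilin M 0 y) x.1‖ ≤ C / (A.radius x.1) ^ (n + 2)

section DocParts

variable {𝓢 : Spacetime.{0} 4} {O : Set 𝓢.carrier} {k : ℕ}

/-- **The charts exhaust the d.o.c. through their d.o.c. parts** (r4 form of `HasExhaustiveDocCharts`,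
recutCovering worker of wave 2): monotone near-zone radii `Rᵢ → ∞` with (i) `C^k` convergence on the growing
truncated slabs, (iii) an OVERLAP MARGIN → ∞ (far parts of the certified tubes, down to `Rᵢ(σ − s₀) − W`, are
eventually inside the radiation zone — what the Kerr–Schild recut needs, V2), and (ii) for EVERY chart time
`τ₁ > τ₀`, every point of the SELF-DETERMINED D.O.C. `O ∩ I⁻(docCharted d)` outside the d.o.c.-certified late
region lies in the causal past of the d.o.c.-certified slab (source restricted: the late collar images, which
the structure forces into `O`, are not asked to reach anything — V1). Honest for Kerr's own development with
horizon-normalised charts. [cite: DafermosLuk2017, Conjecture 1 (b)–(c)] -/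
def HasExhaustiveDocCharts' (d : StationaryFinalStateDecomposition 𝓢 O k) : Prop :=
  ∃ R : Fin d.N → ℝ → ℝ,
    (∀ i, Tendsto (fun τ ↦ 𝓢.truncDeviationCk (d.background i) (d.toOver.chart i) k (R i τ) τ)
      atTop (𝓝 0)) ∧
    (∀ i, Monotone (R i)) ∧ (∀ i, Tendsto (R i) atTop atTop) ∧
    (∀ i, ∀ W s₀ : ℝ, ∀ᶠ σ in atTop,
      d.toOver.chart i '' ({x | (d.background i).time x.1 = σ ∧
        R i (σ - s₀) - W ≤ (d.background i).radius x.1} ∩ docPart d i) ⊆ d.toOver.radiationZone) ∧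
    ∀ τ₁ : ℝ, d.toOver.τ₀ < τ₁ →
      (O ∩ 𝓢.metric.chronologicalPast 𝓢.timeOrientation (docCharted d)) \ docCertifiedLate d R τ₁ ⊆
        𝓢.metric.causalPast 𝓢.timeOrientation (docCertifiedSlab d R τ₁)

end DocParts

/-- **"Every MGHD of `D` settles down to regular stationary vacuum holes with property `Q`"** — r4 currency:
complete `𝓘⁺`; a `C²` stationary decomposition `d` of the honest exterior `O = exteriorOf 𝒟 d.charted`
(collar late images included, as the structure forces), exhaustive in the d.o.c. sense `HasExhaustiveDocCharts'`,
horizon-normalised; adapted hole charts covering `𝓗⁺` (collar, for regularity), asymptotically Cartesian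
immersions with spacelike leaves reaching `i⁰`, asymptotically Schwarzschildean in `C²` with far cylinder in the
d.o.c.; holes in `KerrOrBomb`'s telescope, `I⁺`-regular, with property `Q`. [cite: DafermosLuk2017, §1.2.1] -/
def SettlesDocWith' (Q : StationaryAFBlackHole.{0} → Prop) (X : Type) [TopologicalSpace X]
    [ChartedSpace E3 X] [IsManifold (𝓡 3) ∞ X] [T2Space X] [SecondCountableTopology X]
    [ConnectedSpace X] (D : InitialDataSet (𝓡 3) X) : Prop :=
  ∀ 𝒟 : VacuumCauchyDevelopment D, 𝒟.IsMaximal →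
    Summit.FinalStateConjecture.HasCompleteNullInfinity 𝒟.toCauchyDevelopment ∧
      ∃ (O : Set 𝒟.carrier) (d : StationaryFinalStateDecomposition 𝒟.toSpacetime O 2),
        O = Summit.FinalStateConjecture.exteriorOf 𝒟.toCauchyDevelopment d.charted ∧
          HasExhaustiveDocCharts' d ∧ IsHorizonNormalised d ∧
            ∀ i, (d.hole i).horizon ⊆ Set.range (d.adapted i).toFun ∧
              ChartIsAsymptoticallyCartesian (d.adapted i) ∧
                ChartIsAsymptoticallySchwarzschildean' (d.adapted i) ∧
                  InTelescope (d.hole i) ∧ (d.hole i).IsIPlusRegular ∧ Q (d.hole i)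

/-! ## §1 The four restated stub statements of reshape r4/r5 (precise `Prop`s `Sig4.stub_<name>`; the REGISTERED stubs
of the skeleton are `theorem stub_<name> : Sig4.stub_<name>`; stubs 3/4 are `Sig.stub_*` of p116416, stub 1F is landed) -/

/-- **Stub 1R · `kerrIsometryRigidity` (r4: C²-rate, d.o.c.-anchored chart clause)** — the abstract Kerr isometry of a charted, `I⁺`-regular
telescope hole read in a horizon-covering, asymptotically Cartesian AND asymptotically Schwarzschildean
immersed adapted chart is a `T`-equivariant horizon-regular asymptotically controlled identification
`IsKerrChartedWith`. Wave 1: the r1 statement is FALSE without `I⁺`-regularity (Schwarzschild minus the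
closed future of one horizon generator: telescope hole, collar clause fails) and cannot give a bounded
tilt without a rate; step (iii) (`Θ := A⁻¹ ∘ Φ` from a charted extension `Φ`) is landed,
`isKerrCharted_of_chartedExtension` (p104678). REMAINS (absent from the tree): the Killing algebra of
sub-extremal Kerr (`Ψ^*T = λ∂_{t*}`), the Boyer–Lindquist reflection as an isometry of `Kerr.exterior`,
the horizon extension of a future-preserving `T`-equivariant d.o.c. isometry under `I⁺`-regularity
(Chruściel–Costa §4) — the wave-2 worker's NONE-EXISTS blocker F3 — and asymptotic rigidity of `Θ` at `i⁰`
(F4, provable from the tree's transition rigidity); the Killing algebra F1 is now the Literature fact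
`ONeill1995_kerrKillingFields` (p116586) and the `_with` form of step (iii) is landed (p116587).
(ref: ChruscielCosta2008, Thm. 1.3) -/
def Sig4.stub_kerrIsometryRigidity : Prop :=
  ∀ (𝓑 : StationaryAFBlackHole.{0}) (A : 𝓑.AdaptedChart), InTelescope 𝓑 → 𝓑.IsIPlusRegular →
    𝓑.horizon ⊆ Set.range A.toFun → ChartIsAsymptoticallyCartesian A →
      ChartIsAsymptoticallySchwarzschildean' A → IsKerrExterior 𝓑 →
        ∃ (M a c r₀ : ℝ) (Θ : E4 → E4), IsKerrChartedWith 𝓑 A M a c r₀ Θ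

/-- **Stub 1G · `recutCovering` (r4: hypotheses on the r4 currency; the causal half)** — for a decomposition of the honest
exterior, exhaustive in the d.o.c. sense with overlap margin (`HasExhaustiveDocCharts'`), horizon-normalised, with
regular Kerr-charted holes, the causal covering clauses of the naive
recut hold for some late time and some growing radii (`KerrSchildRecutCovering`): a JUNCTION property of
the flat and Kerr–Schild slab families on the overlap annuli plus the near-horizon causal comparison
(red-shift region) using horizon normalisation, and the transfer of `C²` convergence to GROWING radii
through the asymptotically controlled `Θᵢ`. Nothing of this is in the tree or in print (the summit's own
covering clauses are asserted, never derived); wave 2 (p116597): N = 0 case kernel-proved, the r3 form refuted in exact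
Schwarzschild without the overlap margin (V2). (ref: DafermosLuk2017, Conjecture 1 (b)–(c)) -/
def Sig4.stub_recutCovering : Prop :=
  ∀ (X : Type) [TopologicalSpace X] [ChartedSpace E3 X] [IsManifold (𝓡 3) ∞ X]
    [T2Space X] [SecondCountableTopology X] [ConnectedSpace X] (D : InitialDataSet (𝓡 3) X)
    (𝒟 : VacuumCauchyDevelopment D) (O : Set 𝒟.carrier)
    (d : StationaryFinalStateDecomposition 𝒟.toSpacetime O 2)
    (M a c r₀ : Fin d.N → ℝ) (Θ : Fin d.N → E4 → E4),
    O = Summit.FinalStateConjecture.exteriorOf 𝒟.toCauchyDevelopment d.charted →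
    HasExhaustiveDocCharts' d → IsHorizonNormalised d →
    (∀ i, (d.hole i).horizon ⊆ Set.range (d.adapted i).toFun ∧
      ChartIsAsymptoticallyCartesian (d.adapted i) ∧ InTelescope (d.hole i)) →
    (∀ i, IsKerrChartedWith (d.hole i) (d.adapted i) (M i) (a i) (c i) (r₀ i) (Θ i)) →
    KerrSchildRecutCovering 𝒟 d M a Θ

/-- **Stub 2 · `nonSettlingCure` (r4 currency)** — the global half: data that do not settle regularly IN THE D.O.C.
SENSE, or that settle with an MGHD carrying a local Killing germ at EVERY point of the slice (no
germ-KID-free point: e.g. axisymmetric exceptional data, for which the kick/detector mechanism of stubs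
4–5 has no base point), are curable: a jointly smooth admissible family `F`, `F 0 = D`, injective for
`|c₀| < ε`, whose members `0 < |c₀| < ε` settle in the d.o.c. sense to MODE-STABLE regular holes
(`SettlesDocWith ModeStable`). SIZE: open problem (weak cosmic censorship in Christodoulou's instability
form + large-data settling + a dynamical third law + no-parking + `I⁺`-regularity and rates of the limits,
now also the curing of symmetric exceptional data) — owed by every stationary-limit line; kept as ONE
curve statement (Disproof §5). In this tree no MGHD of any datum is constructible (`MGHDExists` named),
so neither side is certifiable today. (ref: DafermosLuk2017, §1.2.1) -/
def Sig4.stub_nonSettlingCure : Prop :=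
  ∀ (X : Type) [TopologicalSpace X] [ChartedSpace E3 X] [IsManifold (𝓡 3) ∞ X]
    [T2Space X] [SecondCountableTopology X] [ConnectedSpace X],
    ∀ D ∈ admissibleVacuumData X,
      (¬ SettlesDocWith' (fun _ ↦ True) X D ∨
        ∃ 𝒟 : VacuumCauchyDevelopment D, 𝒟.IsMaximal ∧ ∀ x : X, ¬ IsKIDFreeAt 𝒟 x) →
      ∃ (ε : ℝ) (F : EuclideanSpace ℝ (Fin 1) → InitialDataSet (𝓡 3) X), 0 < ε ∧
        InitialDataSet.IsSmoothDataFamily 1 F ∧ F 0 = D ∧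
        (∀ c c' : EuclideanSpace ℝ (Fin 1), |c 0| < ε → |c' 0| < ε → F c = F c' → c = c') ∧
        (∀ c : EuclideanSpace ℝ (Fin 1), |c 0| < ε → F c ∈ admissibleVacuumData X) ∧
        ∀ c : EuclideanSpace ℝ (Fin 1), c ≠ 0 → |c 0| < ε → SettlesDocWith' ModeStable X (F c)

-- Stub 1F in general position (`stub_chartTransferGeneral`, r4) is LANDED: `Theorems.SymplecticDualOfTheBomb.stub_chartTransferGeneral`
-- (p121011) — `O = exteriorOf 𝒟 d.charted` + `∀ i, IsKerrChartedWith …` + `KerrSchildRecutCovering 𝒟 d M a Θ` ⇒ the summit's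
-- Kerr–Schild decomposition triple; it is called by name in §3/§4 below and is no longer a stub of this skeleton.

-- Stubs 3 (`Sig.stub_probeUniversality`) and 4 (`Sig.stub_moncriefFacts`) are UNCHANGED and their statements are the
-- landed definitions of `Theorems/ZeroEnergyKerrOrBombSymplecticDualOfTheBombSig.lean` (p116416); wave 2 (p115964):
-- `stub_moncriefFacts` passed its junk audit — TRUE and correctly typed, NONE-EXISTS as stated (Corvino–Schoen /
-- Chruściel–Delay local deformation printed up to assembly; local Moncrief duality printed only globally).

/-- **Stub 5 · `dualModeEjection` (r4 currency)** — the symplectic dual of the bomb detects at a germ-KID-free point,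
and transversal steerable families escape: for an admissible `D`, an MGHD with complete `𝓘⁺` and a `C²`
stationary decomposition IN THE D.O.C. SENSE (exterior from `docCharted`, `HasExhaustiveDocCharts`,
horizon-normalised, regular holes as in `SettlesDocWith`) whose hole `i` carries a growing gravitational
Killing-mode pair, and which HAS a germ-KID-free point: there are a germ-KID-free point `x₀` and finitely
many SYMMETRIC detectors at `x₀` (`AreSymmDetectorsAt`) such that every jointly smooth admissible
`k`-family through `D` supported in the chart source at `x₀` with non-degenerate pairing matrix contains a
jointly smooth locally injective curve all of whose members `0 < |c₀| < ε` settle (d.o.c. sense) to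
MODE-STABLE regular holes. Wave 1 (p104819): the r1 text collapsed (antisymmetric detectors; KID-freeness
on the conclusion side = global no-KID, false for symmetric bombs). Debts (all absent): dual-mode
transport by the conserved symplectic current + local non-gauge-ness of the dual mode at some KID-free
point, the saddle (isolated growing eigenvalue, strong-unstable shadowing) and the fate of the explosion.
(ref: DafermosLuk2017, §1.2.1) -/
def Sig4.stub_dualModeEjection : Prop :=
  ∀ (X : Type) [TopologicalSpace X] [ChartedSpace E3 X] [IsManifold (𝓡 3) ∞ X]
    [T2Space X] [SecondCountableTopology X] [ConnectedSpace X],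
    ∀ D ∈ admissibleVacuumData X, ∀ (𝒟 : VacuumCauchyDevelopment D), 𝒟.IsMaximal →
      Summit.FinalStateConjecture.HasCompleteNullInfinity 𝒟.toCauchyDevelopment →
      ∀ (O : Set 𝒟.carrier) (d : StationaryFinalStateDecomposition 𝒟.toSpacetime O 2),
        O = Summit.FinalStateConjecture.exteriorOf 𝒟.toCauchyDevelopment d.charted →
        HasExhaustiveDocCharts' d → IsHorizonNormalised d →
        (∀ i, (d.hole i).horizon ⊆ Set.range (d.adapted i).toFun ∧
          ChartIsAsymptoticallyCartesian (d.adapted i) ∧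
            ChartIsAsymptoticallySchwarzschildean' (d.adapted i) ∧
              InTelescope (d.hole i) ∧ (d.hole i).IsIPlusRegular) →
        ∀ (i : Fin d.N) (ν ϖ : ℝ) (h₁ h₂ : HoleBilinField (d.hole i)), 0 < ν →
          IsGravitationalModePair (d.hole i) (d.adapted i) ν ϖ h₁ h₂ →
          (∃ x : X, IsKIDFreeAt 𝒟 x) →
          ∃ (x₀ : X) (k : ℕ) (A B : Fin k → BilinField X), AreSymmDetectorsAt 𝒟 x₀ A B ∧
            ∀ G : EuclideanSpace ℝ (Fin k) → InitialDataSet (𝓡 3) X,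
              InitialDataSet.IsSmoothDataFamily k G → G 0 = D → (∀ c, G c ∈ admissibleVacuumData X) →
              (∃ K : Set X, IsCompact K ∧ K ⊆ (extChartAt (𝓡 3) x₀).source ∧ IsSupportedIn D G K) →
              (pairingMatrix D x₀ A B G).det ≠ 0 →
              ∃ (ε : ℝ) (F : EuclideanSpace ℝ (Fin 1) → InitialDataSet (𝓡 3) X), 0 < ε ∧
                InitialDataSet.IsSmoothDataFamily 1 F ∧ F 0 = D ∧
                (∀ c, ∃ c', F c = G c') ∧
                (∀ c c' : EuclideanSpace ℝ (Fin 1), |c 0| < ε → |c' 0| < ε → F c = F c' → c = c') ∧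
                ∀ c : EuclideanSpace ℝ (Fin 1), c ≠ 0 → |c 0| < ε → SettlesDocWith' ModeStable X (F c)

/-- Read-back of `SettlesDocWith'` (definitional). Registration device of this module (as `settlesDocWith_iff` of
`…Defs2`). [folklore] -/
theorem settlesDocWith'_iff : ∀ (Q : StationaryAFBlackHole.{0} → Prop) (X : Type) [TopologicalSpace X] [ChartedSpace E3 X] [IsManifold (𝓡 3) ∞ X] [T2Space X] [SecondCountableTopology X] [ConnectedSpace X] (D : InitialDataSet (𝓡 3) X), SettlesDocWith' Q X D ↔ ∀ 𝒟 : VacuumCauchyDevelopment D, 𝒟.IsMaximal → Summit.FinalStateConjecture.HasCompleteNullInfinity 𝒟.toCauchyDevelopment ∧ ∃ (O : Set 𝒟.carrier) (d : StationaryFinalStateDecomposition 𝒟.toSpacetime O 2), O = Summit.FinalStateConjecture.exteriorOf 𝒟.toCauchyDevelopment d.charted ∧ HasExhaustiveDocCharts' d ∧ IsHorizonNormalised d ∧ ∀ i, (d.hole i).horizon ⊆ Set.range (d.adapted i).toFun ∧ ChartIsAsymptoticallyCartesian (d.adapted i) ∧ ChartIsAsymptoticallySchwarzschildean' (d.adapted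 i) ∧ InTelescope (d.hole i) ∧ (d.hole i).IsIPlusRegular ∧ Q (d.hole i) :=
  fun _ _ _ _ _ _ _ _ _ ↦ Iff.rfl

/-- `SettlesDocWith'` is monotone in the hole property (as `settlesDocWith_mono` of `…Defs2`; registered helper of
stmt-FinalStateConjecture-10021, used by the skeleton's `exists_bomb_doc`). [folklore] -/
theorem settlesDocWith'_mono : ∀ (Q Q' : StationaryAFBlackHole.{0} → Prop) (X : Type) [TopologicalSpace X] [ChartedSpace E3 X] [IsManifold (𝓡 3) ∞ X] [T2Space X] [SecondCountableTopology X] [ConnectedSpace X] (D : InitialDataSet (𝓡 3) X), (∀ 𝓑, Q 𝓑 → Q' 𝓑) → SettlesDocWith' Q X D → SettlesDocWith' Q' X D := by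
  intro Q Q' X _ _ _ _ _ _ D hQ h 𝒟 h𝒟
  obtain ⟨hcni, O, d, hO, hex, hnorm, hholes⟩ := h 𝒟 h𝒟
  exact ⟨hcni, O, d, hO, hex, hnorm, fun i ↦ ⟨(hholes i).1, (hholes i).2.1, (hholes i).2.2.1,
    (hholes i).2.2.2.1, (hholes i).2.2.2.2.1, hQ _ (hholes i).2.2.2.2.2⟩⟩

end Summit.FinalStateConjecture.FinalStateConjecture.Theorems.SymplecticDualOfTheBomb

end
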